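import Mathlib
import Summits.ValiantsHypothesis.ValiantsHypothesis.Theses.FermionizationDimension
import Literature.Computability.AlgebraicComplexity.ValiantClassesProofs
import Literature.Computability.AlgebraicComplexity.ValiantConjectureEquivProofs
import Summits.ValiantsHypothesis.ValiantsHypothesis.Theorems.DetqpThesis.Negative.Variants
import Summits.ValiantsHypothesis.ValiantsHypothesis.Theorems.ClassTransfer.Negative.BlockSums

/-!
# Crux `ClassTransfer` (stmt-ValiantsHypothesis-7287): the route's cheapest falsifier is
# PERMANENT-HARD — `T ∈ VP ⇒ VP = VNP`

Lead prover of line `registered` (= `Cruxes/ClassTransfer/Lines/birth.lean`), negative side of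
the crux `…Theses.FermionizationDimension.ClassTransfer`.  The route header (KILL CRITERIA /
CHEAPEST FALSIFIER) and the crux's own "why it might fail" name one concrete test: the
class-function family `T_n(t) = Σ_σ sgn(σ) t^{c₂(σ)} x^σ` (`c₂` = number of 2-cycles; `t = 0` is
the 2-cycle-free determinant `D₂`) — "in VP ⇒ the crux is in acute danger", and indeed
`Negative/TwoCycleWeight.lean` proves `T(4) ∈ VP ⇒ ¬ ClassTransfer`.  This file settles the
test the other way, unconditionally:

**`T(4) ∈ VP ⇒ VP_ℂ = VNP_ℂ`** (`VP_eq_VNP_of_isVPFamily_twoCycleWeight`), because **the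
permanent is a projection of `T` at double size** (`isProjection_perPoly_twoCycleWeight`):
substituting the block-antidiagonal matrix `[[0, κJ_m], [X, 0]]` into `T_{2m}`, only the block
maps `σ = (inl i ↦ inr (α i), inr j ↦ inl (β j))` survive (`sum_perm_blockAntidiag`); for them
`c₂(σ) = c₁(βα)` and `sgn σ = ± sgn α sgn β`, so summing over `β` first leaves
`± κ^m · (Σ_γ sgn γ 4^{c₁ γ}) · Σ_α ∏_i X_{α(i),i}` — a nonzero constant
(`Σ_γ sgn γ 4^{c₁ γ} = det(3·1 + J) = 3^m (1 + m/3)`, `sum_sign_mul_four_pow_fixed_ne_zero`) times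
`per_m(X)`, and the `m`-th root `κ` normalises the constant to `1`.  On paper the same
substitution gives `T_{2m}(t)([[0, J], [X, 0]]) = (-1)^m (t-1)^{m-1} (t+m-1) · per_m(X)` for every
`t`, so `T(t)` is permanent-hard for all `t ≠ 1`.  Formalised: the block projection for an
ARBITRARY weight `w(N₂(σ))` of `N₂(σ) = #{x : σ²x = x ≠ σx} = 2c₂(σ)` whenever the constant
`Σ_γ sgn γ · w(2 c₁ γ)` is nonzero (`isProjection_perPoly_weightedTwoCycle`), and the two members
named by the route — `t = 4` (weight `2^{N₂}`, inlined exactly as in `Negative/TwoCycleWeight.lean`)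
and `t = 0` (the 2-cycle-free determinant `D₂`, weight `[N₂ = 0]`, signed derangement constant,
sizes `2m + 2` via `per_m ≤ per_{m+1}`).

Consequences (`isPProjection_perPoly_twoCycleWeight`, `isVPFamily_perPoly_of_isVPFamily_…`,
`VP_eq_VNP_of_isVPFamily_twoCycleWeight`, `not_isVPFamily_twoCycleWeight_of_valiantsHypothesis`,
`isPProjection_perPoly_twoCycleFreeDet`, `VP_eq_VNP_of_isVPFamily_twoCycleFreeDet`): with the
tree's closure of `VP` under p-projections and its `VNP`-completeness of the permanent over `ℂ`
(`isPComputable_perPoly_complex_iff`), a `VP` upper bound for `T(4)` or for `D₂` would refute not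
just the crux but the summit.  So `ClassTransfer` passes its sharpest recorded test in every world in which
`ValiantsHypothesis` holds — the falsifier named by the planner cannot separate the crux from
the summit.  No definitions.  References: block substitutions reducing the permanent to
permanent-like sums are folklore (Valiant 1979 style projections); Bürgisser 2000 §2.1 for
p-projections. [folklore]
-/

set_option linter.dupNamespace false

noncomputable section

namespace Summit.ValiantsHypothesis.ValiantsHypothesis.Theorems.ClassTransfer.Negative

open Equiv Finset

/-! ## The permanent is a projection of the two-cycle weight family at double size -/

/-- **`per_m` is a projection of the weighted family `T_{w,2m} = Σ_σ sgn(σ) w(N₂(σ)) x^σ`**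
(`N₂(σ) = #{x : σ²x = x ≠ σx}`, twice the number of 2-cycles) as soon as the constant
`D_w(m) = Σ_{γ ∈ S_m} sgn(γ) w(2 c₁(γ))` is nonzero.  Substitute the block-antidiagonal matrix
`[[0, κJ], [X, 0]]`: only block maps `σ = (inl i ↦ inr (α i), inr j ↦ inl (β j))` survive
(`sum_perm_blockAntidiag`), `N₂(σ) = 2 #{i : β(α i) = i}` and `sgn σ = sgn(sumComm) sgn α sgn β`;
summing over `β` first gives `sgn(α) · D_w(m)`, so the total is a NONZERO constant times
`Σ_α ∏_i X(α i, i) = per_m`, and `κ` (an `m`-th root) normalises the constant to `1`.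
[folklore] -/
theorem isProjection_perPoly_weightedTwoCycle (w : ℕ → ℂ) (m : ℕ) (hm : 0 < m)
    (hD0 : ∑ γ : Perm (Fin m), ((Perm.sign γ : ℤ) : ℂ) *
      w (2 * (univ.filter fun i : Fin m => γ i = i).card) ≠ 0) :
    Literature.Computability.AlgebraicComplexity.IsProjection
      (Literature.Computability.AlgebraicComplexity.perPoly (Fin m) ℂ)
      (∑ σ : Equiv.Perm (Fin (m + m)),
        MvPolynomial.C (((Equiv.Perm.sign σ : ℤ) : ℂ) *
            w (univ.filter fun x : Fin (m + m) => σ (σ x) = x ∧ σ x ≠ x).card) *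
          ∏ i : Fin (m + m), MvPolynomial.X (σ i, i)) := by
  classical
  -- the constants
  set εc : ℂ := ((Perm.sign (Equiv.sumComm (Fin m) (Fin m)) : ℤ) : ℂ) with hεc
  set D : ℂ := ∑ γ : Perm (Fin m), ((Perm.sign γ : ℤ) : ℂ) *
    w (2 * (univ.filter fun i : Fin m => γ i = i).card) with hD
  have hε0 : εc ≠ 0 := by
    rcases Int.units_eq_one_or (Perm.sign (Equiv.sumComm (Fin m) (Fin m))) with h1 | h1 <;>
      simp [hεc, h1]
  obtain ⟨κ, hκ⟩ : ∃ κ : ℂ, κ ^ m = (εc * D)⁻¹ := IsAlgClosed.exists_pow_nat_eq _ hm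
  -- the substitution: `[[0, κ J], [X, 0]]` in block coordinates `Fin m ⊕ Fin m ≃ Fin (m + m)`
  set e : Fin m ⊕ Fin m ≃ Fin (m + m) := finSumFinEquiv with he
  set E' : (Fin m ⊕ Fin m) → (Fin m ⊕ Fin m) → MvPolynomial (Fin m × Fin m) ℂ := fun r c =>
    Sum.elim (fun _ => Sum.elim (fun _ => (0 : MvPolynomial (Fin m × Fin m) ℂ))
        (fun _ => MvPolynomial.C κ) c)
      (fun r' => Sum.elim (fun c' => MvPolynomial.X (r', c')) (fun _ => 0) c) r with hE'
  have hLL : ∀ i j, E' (Sum.inl i) (Sum.inl j) = 0 := fun _ _ => rfl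
  have hRR : ∀ i j, E' (Sum.inr i) (Sum.inr j) = 0 := fun _ _ => rfl
  have hRL : ∀ i j, E' (Sum.inr i) (Sum.inl j) = MvPolynomial.X (i, j) := fun _ _ => rfl
  have hLR : ∀ i j, E' (Sum.inl i) (Sum.inr j) = MvPolynomial.C κ := fun _ _ => rfl
  set a : Fin (m + m) × Fin (m + m) → MvPolynomial (Fin m × Fin m) ℂ :=
    fun rc => E' (e.symm rc.1) (e.symm rc.2) with ha
  refine ⟨a, ?_, ?_⟩
  · -- every substituted entry is a variable or a constant
    rintro ⟨r, c⟩
    simp only [ha]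
    generalize e.symm r = u
    generalize e.symm c = v
    rcases u with r' | r' <;> rcases v with c' | c'
    · exact Or.inr ⟨0, by rw [hLL, map_zero]⟩
    · exact Or.inr ⟨κ, hLR r' c'⟩
    · exact Or.inl ⟨(r', c'), hRL r' c'⟩
    · exact Or.inr ⟨0, by rw [hRR, map_zero]⟩
  · -- the identity `per_m = aeval a T_{m+m}`
    symm
    -- push `aeval` through
    rw [map_sum]
    have hterm : ∀ σ : Perm (Fin (m + m)),
        MvPolynomial.aeval a (MvPolynomial.C (((Equiv.Perm.sign σ : ℤ) : ℂ) *
            w (univ.filter fun x : Fin (m + m) => σ (σ x) = x ∧ σ x ≠ x).card) *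
          ∏ i : Fin (m + m), MvPolynomial.X (σ i, i)) =
        MvPolynomial.C (((Equiv.Perm.sign σ : ℤ) : ℂ) *
            w (univ.filter fun x : Fin (m + m) => σ (σ x) = x ∧ σ x ≠ x).card) *
          ∏ i : Fin (m + m), a (σ i, i) := by
      intro σ
      rw [map_mul, map_prod, MvPolynomial.aeval_C, MvPolynomial.algebraMap_eq]
      simp only [MvPolynomial.aeval_X]
    rw [Finset.sum_congr rfl fun σ _ => hterm σ]
    -- transport the permutation sum to `Fin m ⊕ Fin m`
    rw [← Fintype.sum_equiv e.permCongr
      (fun σ' => MvPolynomial.C (((Equiv.Perm.sign (e.permCongr σ') : ℤ) : ℂ) *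
          w (univ.filter fun x : Fin (m + m) =>
            (e.permCongr σ') ((e.permCongr σ') x) = x ∧ (e.permCongr σ') x ≠ x).card) *
        ∏ y : Fin m ⊕ Fin m, E' (σ' y) y) _ (fun σ' => ?_)]
    swap
    · congr 1
      rw [← Fintype.prod_equiv e (fun y => a ((e.permCongr σ') (e y), e y)) _ (fun _ => rfl)]
      refine Fintype.prod_congr _ _ fun y => ?_
      simp [ha, Equiv.permCongr_apply]
    -- only block maps survive
    rw [sum_perm_blockAntidiag _ E' hLL hRR]
    simp only [hRL, hLR, Finset.prod_const, Finset.card_univ, Fintype.card_fin]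
    -- evaluate sign and two-cycle count of a block map
    have hsign : ∀ p : Perm (Fin m) × Perm (Fin m),
        Perm.sign (e.permCongr ((Equiv.sumCongr p.1 p.2).trans (Equiv.sumComm (Fin m) (Fin m)))) =
          Perm.sign (Equiv.sumComm (Fin m) (Fin m)) * (Perm.sign p.1 * Perm.sign p.2) := by
      intro p
      rw [Perm.sign_permCongr, ← Perm.mul_def, Perm.sign_mul]
      congr 1
      exact Perm.sign_sumCongr p.1 p.2
    have hN2 : ∀ p : Perm (Fin m) × Perm (Fin m),
        (univ.filter fun x : Fin (m + m) =>
          (e.permCongr ((Equiv.sumCongr p.1 p.2).trans (Equiv.sumComm (Fin m) (Fin m))))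
            ((e.permCongr ((Equiv.sumCongr p.1 p.2).trans (Equiv.sumComm (Fin m) (Fin m)))) x)
              = x ∧
          (e.permCongr ((Equiv.sumCongr p.1 p.2).trans (Equiv.sumComm (Fin m) (Fin m)))) x ≠ x).card
        = 2 * (univ.filter fun i : Fin m => p.2 (p.1 i) = i).card := by
      rintro ⟨α, β⟩
      set ρ := e.permCongr ((Equiv.sumCongr α β).trans (Equiv.sumComm (Fin m) (Fin m))) with hρ
      have hl : ∀ i, ρ (e (Sum.inl i)) = e (Sum.inr (α i)) := by
        intro i; simp [hρ, Equiv.permCongr_apply]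
      have hr : ∀ j, ρ (e (Sum.inr j)) = e (Sum.inl (β j)) := by
        intro j; simp [hρ, Equiv.permCongr_apply]
      have hmap : (univ.filter fun x : Fin (m + m) => ρ (ρ x) = x ∧ ρ x ≠ x) =
          ((univ : Finset (Fin m ⊕ Fin m)).filter
            (fun y => ρ (ρ (e y)) = e y ∧ ρ (e y) ≠ e y)).map e.toEmbedding := by
        rw [← Finset.map_univ_equiv e, Finset.filter_map]
        rfl
      rw [hmap, Finset.card_map, Finset.card_filter, Fintype.sum_sum_type]
      have hl' : ∀ i : Fin m, (ρ (ρ (e (Sum.inl i))) = e (Sum.inl i) ∧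
          ρ (e (Sum.inl i)) ≠ e (Sum.inl i)) ↔ β (α i) = i := by
        intro i
        rw [hl, hr]
        constructor
        · rintro ⟨h1, -⟩
          exact Sum.inl_injective (e.injective h1)
        · intro h
          refine ⟨by rw [h], fun h' => ?_⟩
          exact absurd (e.injective h') Sum.inr_ne_inl
      have hr' : ∀ j : Fin m, (ρ (ρ (e (Sum.inr j))) = e (Sum.inr j) ∧
          ρ (e (Sum.inr j)) ≠ e (Sum.inr j)) ↔ α (β j) = j := by
        intro j
        rw [hr, hl]
        constructor
        · rintro ⟨h1, -⟩
          exact Sum.inr_injective (e.injective h1)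
        · intro h
          refine ⟨by rw [h], fun h' => ?_⟩
          exact absurd (e.injective h') Sum.inl_ne_inr
      rw [Finset.sum_congr rfl fun i _ => if_congr (hl' i) rfl rfl,
        Finset.sum_congr rfl fun j _ => if_congr (hr' j) rfl rfl,
        Fintype.sum_equiv β (fun j => if α (β j) = j then 1 else 0)
          (fun i => if β (α i) = i then 1 else 0)
          (fun j => by by_cases h : α (β j) = j <;> simp [h]),
        ← Finset.card_filter, two_mul]
    simp only [hsign, hN2]
    -- sum over `β` first: `Σ_β sgn β 4^{#{i : β (α i) = i}} = sgn α · D`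
    rw [Fintype.sum_prod_type]
    have hinner : ∀ α : Perm (Fin m),
        ∑ β : Perm (Fin m), ((Perm.sign β : ℤ) : ℂ) *
            w (2 * (univ.filter fun i : Fin m => β (α i) = i).card) =
          ((Perm.sign α : ℤ) : ℂ) * D := by
      intro α
      rw [hD, Finset.mul_sum]
      refine Fintype.sum_equiv (Equiv.mulRight α) _ _ fun β => ?_
      have hsq : ((Perm.sign α : ℤ) : ℂ) * ((Perm.sign α : ℤ) : ℂ) = 1 := by
        rw [← Int.cast_mul, ← Units.val_mul, Int.units_mul_self]
        simp
      simp only [Equiv.coe_mulRight, Perm.sign_mul, Units.val_mul, Int.cast_mul, Perm.mul_apply]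
      rw [show ((Perm.sign α : ℤ) : ℂ) * (((Perm.sign β : ℤ) : ℂ) * ((Perm.sign α : ℤ) : ℂ) *
          w (2 * (univ.filter fun i : Fin m => β (α i) = i).card)) =
          (((Perm.sign α : ℤ) : ℂ) * ((Perm.sign α : ℤ) : ℂ)) * (((Perm.sign β : ℤ) : ℂ) *
            w (2 * (univ.filter fun i : Fin m => β (α i) = i).card)) by ring, hsq, one_mul]
    dsimp only
    -- sum over `β` for each `α`, normalise the constant with `κ`
    have hα : ∀ α : Perm (Fin m),
        ∑ β : Perm (Fin m), MvPolynomial.C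
            ((((Perm.sign (Equiv.sumComm (Fin m) (Fin m)) * (Perm.sign α * Perm.sign β) : ℤˣ) :
                ℤ) : ℂ) * w (2 * (univ.filter fun i : Fin m => β (α i) = i).card)) *
            ((∏ i : Fin m, MvPolynomial.X (α i, i)) * MvPolynomial.C κ ^ m) =
          ∏ i : Fin m, (MvPolynomial.X (α i, i) : MvPolynomial (Fin m × Fin m) ℂ) := by
      intro α
      have hC : ∀ β : Perm (Fin m), MvPolynomial.C
            ((((Perm.sign (Equiv.sumComm (Fin m) (Fin m)) * (Perm.sign α * Perm.sign β) : ℤˣ) :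
                ℤ) : ℂ) * w (2 * (univ.filter fun i : Fin m => β (α i) = i).card)) *
            ((∏ i : Fin m, MvPolynomial.X (α i, i)) * MvPolynomial.C κ ^ m) =
          (MvPolynomial.C (εc * κ ^ m) * ∏ i : Fin m, MvPolynomial.X (α i, i)) *
            MvPolynomial.C (((Perm.sign α : ℤ) : ℂ) * (((Perm.sign β : ℤ) : ℂ) *
              w (2 * (univ.filter fun i : Fin m => β (α i) = i).card))) := by
        intro β
        rw [Units.val_mul, Units.val_mul, Int.cast_mul, Int.cast_mul, ← hεc]
        simp only [map_mul, map_pow]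
        ring
      rw [Finset.sum_congr rfl fun β _ => hC β, ← Finset.mul_sum, ← map_sum, ← Finset.mul_sum,
        hinner α]
      have hsq : ((Perm.sign α : ℤ) : ℂ) * ((Perm.sign α : ℤ) : ℂ) = 1 := by
        rw [← Int.cast_mul, ← Units.val_mul, Int.units_mul_self]
        simp
      have hone : εc * κ ^ m * (((Perm.sign α : ℤ) : ℂ) * (((Perm.sign α : ℤ) : ℂ) * D)) = 1 := by
        rw [hκ, ← mul_assoc ((Perm.sign α : ℤ) : ℂ), hsq, one_mul]
        field_simp
      rw [mul_comm (MvPolynomial.C (εc * κ ^ m)) _, mul_assoc, ← map_mul, hone, map_one, mul_one]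
    rw [Finset.sum_congr rfl fun α _ => hα α]
    simp [Literature.Computability.AlgebraicComplexity.perPoly, Matrix.permanent,
      Matrix.mvPolynomialX]


/-- The degenerate size `m = 0`: `per_0 = 1 = T_0` whenever the weight has `w 0 = 1`.
[folklore] -/
theorem isProjection_perPoly_weightedTwoCycle_zero (w : ℕ → ℂ) (hw : w 0 = 1) :
    Literature.Computability.AlgebraicComplexity.IsProjection
      (Literature.Computability.AlgebraicComplexity.perPoly (Fin 0) ℂ)
      (∑ σ : Equiv.Perm (Fin (0 + 0)),
        MvPolynomial.C (((Equiv.Perm.sign σ : ℤ) : ℂ) *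
            w (univ.filter fun x : Fin (0 + 0) => σ (σ x) = x ∧ σ x ≠ x).card) *
          ∏ i : Fin (0 + 0), MvPolynomial.X (σ i, i)) := by
  refine ⟨fun _ => 0, fun _ => Or.inr ⟨0, (map_zero _).symm⟩, ?_⟩
  have h1 : Literature.Computability.AlgebraicComplexity.perPoly (Fin 0) ℂ = 1 := by
    simp [Literature.Computability.AlgebraicComplexity.perPoly, Matrix.permanent_isEmpty]
  rw [h1, map_sum]
  simp [hw]

/-! ## Family level, `t = 4`: `T ∈ VP ⇒ per ∈ VP ⇒ VP = VNP` -/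

/-- **The permanent family is a p-projection of the two-cycle weight family
`T_n = Σ_σ sgn(σ) 2^{N₂(σ)} x^σ`** (`t(m) = 2m`; constant `Σ_γ sgn γ 4^{c₁ γ} ≠ 0`). [folklore] -/
theorem isPProjection_perPoly_twoCycleWeight :
    Literature.Computability.AlgebraicComplexity.IsPProjection
      (fun m => Literature.Computability.AlgebraicComplexity.perPoly (Fin m) ℂ)
      (fun n => ∑ σ : Equiv.Perm (Fin n),
        MvPolynomial.C (((Equiv.Perm.sign σ : ℤ) : ℂ) *
            (2 : ℂ) ^ (univ.filter fun x : Fin n => σ (σ x) = x ∧ σ x ≠ x).card) *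
          ∏ i : Fin n, MvPolynomial.X (σ i, i)) := by
  refine ⟨fun m => m + m, ⟨2, fun n => by nlinarith⟩, fun m => ?_⟩
  rcases Nat.eq_zero_or_pos m with rfl | hm
  · exact isProjection_perPoly_weightedTwoCycle_zero (fun k => (2 : ℂ) ^ k) (pow_zero _)
  · refine isProjection_perPoly_weightedTwoCycle (fun k => (2 : ℂ) ^ k) m hm ?_
    have h4 : ∀ k : ℕ, (2 : ℂ) ^ (2 * k) = (4 : ℂ) ^ k := fun k => by
      rw [pow_mul]; norm_num
    simp only [h4]
    exact sum_sign_mul_four_pow_fixed_ne_zero m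

/-- **If `T_n = Σ_σ sgn(σ) 2^{N₂(σ)} x^σ` is in `VP`, so is the permanent family** (`VP` is closed
under p-projections among p-families: `IsVPFamily.of_isPProjection_holds`,
`isPFamily_perPoly_holds`). [folklore] -/
theorem isVPFamily_perPoly_of_isVPFamily_twoCycleWeight
    (hVP : Literature.Computability.AlgebraicComplexity.IsVPFamily
      (fun n => ∑ σ : Equiv.Perm (Fin n),
        MvPolynomial.C (((Equiv.Perm.sign σ : ℤ) : ℂ) *
            (2 : ℂ) ^ (univ.filter fun x : Fin n => σ (σ x) = x ∧ σ x ≠ x).card) *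
          ∏ i : Fin n, MvPolynomial.X (σ i, i))) :
    Literature.Computability.AlgebraicComplexity.IsVPFamily
      (fun m => Literature.Computability.AlgebraicComplexity.perPoly (Fin m) ℂ) :=
  Literature.Computability.AlgebraicComplexity.IsVPFamily.of_isPProjection_holds
    (Literature.Computability.AlgebraicComplexity.isPFamily_perPoly_holds (k := ℂ))
    isPProjection_perPoly_twoCycleWeight hVP

/-- **The route's cheapest falsifier is permanent-hard: `T ∈ VP ⇒ VP = VNP`** (over `ℂ`;
`isPComputable_perPoly_complex_iff`, the `VNP`-completeness of the permanent, proved in tree).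
[folklore] -/
theorem VP_eq_VNP_of_isVPFamily_twoCycleWeight
    (hVP : Literature.Computability.AlgebraicComplexity.IsVPFamily
      (fun n => ∑ σ : Equiv.Perm (Fin n),
        MvPolynomial.C (((Equiv.Perm.sign σ : ℤ) : ℂ) *
            (2 : ℂ) ^ (univ.filter fun x : Fin n => σ (σ x) = x ∧ σ x ≠ x).card) *
          ∏ i : Fin n, MvPolynomial.X (σ i, i))) :
    Literature.Computability.AlgebraicComplexity.VP ℂ =
      Literature.Computability.AlgebraicComplexity.VNP ℂ :=
  Literature.Computability.AlgebraicComplexity.isPComputable_perPoly_complex_iff.1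
    (isVPFamily_perPoly_of_isVPFamily_twoCycleWeight hVP).2

/-- **Under Valiant's hypothesis the falsifier does not exist**: `VP ≠ VNP ⇒ T ∉ VP`.  Together
with `Negative/TwoCycleWeight.lean` (`T ∈ VP ⇒ ¬ ClassTransfer`): on the family `T` the crux
`ClassTransfer` can only be refuted in a world where the summit itself is false. [folklore] -/
theorem not_isVPFamily_twoCycleWeight_of_valiantsHypothesis (hVH : _root_.ValiantsHypothesis) :
    ¬ Literature.Computability.AlgebraicComplexity.IsVPFamily
      (fun n => ∑ σ : Equiv.Perm (Fin n),
        MvPolynomial.C (((Equiv.Perm.sign σ : ℤ) : ℂ) *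
            (2 : ℂ) ^ (univ.filter fun x : Fin n => σ (σ x) = x ∧ σ x ≠ x).card) *
          ∏ i : Fin n, MvPolynomial.X (σ i, i)) :=
  fun hVP => hVH (VP_eq_VNP_of_isVPFamily_twoCycleWeight hVP)

/-! ## Family level, `t = 0`: the 2-cycle-free determinant `D₂` is permanent-hard too -/

/-- **The permanent family is a p-projection of the 2-cycle-free determinant family
`D₂,n = Σ_{σ : c₂(σ) = 0} sgn(σ) x^σ`** (sizes `t(0) = 0`, `t(m) = 2m + 2`: `per_m ≤ per_{m+1}`
is a projection of `D₂,2m+2`, the signed derangement constant being nonzero from size `2` on).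
[folklore] -/
theorem isPProjection_perPoly_twoCycleFreeDet :
    Literature.Computability.AlgebraicComplexity.IsPProjection
      (fun m => Literature.Computability.AlgebraicComplexity.perPoly (Fin m) ℂ)
      (fun n => ∑ σ : Equiv.Perm (Fin n),
        MvPolynomial.C (((Equiv.Perm.sign σ : ℤ) : ℂ) *
            (if (univ.filter fun x : Fin n => σ (σ x) = x ∧ σ x ≠ x).card = 0 then (1 : ℂ)
              else 0)) *
          ∏ i : Fin n, MvPolynomial.X (σ i, i)) := by
  refine ⟨fun m => if m = 0 then 0 else (m + 1) + (m + 1),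
    (Literature.Computability.AlgebraicComplexity.IsPBounded.iff_exists_le_mul_succ_pow _).2
      ⟨2, 1, fun n => ?_⟩, fun m => ?_⟩
  · rw [pow_one]
    split_ifs <;> omega
  dsimp only
  rcases Nat.eq_zero_or_pos m with rfl | hm
  · rw [if_pos rfl]
    exact isProjection_perPoly_weightedTwoCycle_zero (fun k => if k = 0 then (1 : ℂ) else 0)
      (if_pos rfl)
  · rw [if_neg hm.ne']
    refine Literature.Computability.AlgebraicComplexity.IsProjection.trans_holds
      (Summit.ValiantsHypothesis.Theorems.DetqpThesis.Negative.isProjection_perPoly_succ ℂ m) ?_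
    refine isProjection_perPoly_weightedTwoCycle (fun k => if k = 0 then (1 : ℂ) else 0)
      (m + 1) (Nat.succ_pos m) ?_
    have h2 : ∀ k : ℕ, (if 2 * k = 0 then (1 : ℂ) else 0) = if k = 0 then (1 : ℂ) else 0 :=
      fun k => by simp
    simp only [h2]
    exact sum_sign_mul_indicator_derangement_ne_zero (m + 1) (by omega)

/-- **`D₂ ∈ VP ⇒ VP = VNP`**: the 2-cycle-free determinant (the `t = 0` member of the route's
falsifier pencil, named separately in the crux's "why it might fail") is permanent-hard as well.
[folklore] -/
theorem VP_eq_VNP_of_isVPFamily_twoCycleFreeDet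
    (hVP : Literature.Computability.AlgebraicComplexity.IsVPFamily
      (fun n => ∑ σ : Equiv.Perm (Fin n),
        MvPolynomial.C (((Equiv.Perm.sign σ : ℤ) : ℂ) *
            (if (univ.filter fun x : Fin n => σ (σ x) = x ∧ σ x ≠ x).card = 0 then (1 : ℂ)
              else 0)) *
          ∏ i : Fin n, MvPolynomial.X (σ i, i))) :
    Literature.Computability.AlgebraicComplexity.VP ℂ =
      Literature.Computability.AlgebraicComplexity.VNP ℂ :=
  Literature.Computability.AlgebraicComplexity.isPComputable_perPoly_complex_iff.1
    (Literature.Computability.AlgebraicComplexity.IsVPFamily.of_isPProjection_holds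
      (Literature.Computability.AlgebraicComplexity.isPFamily_perPoly_holds (k := ℂ))
      isPProjection_perPoly_twoCycleFreeDet hVP).2

end Summit.ValiantsHypothesis.ValiantsHypothesis.Theorems.ClassTransfer.Negative
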